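import Literature.NumberTheory.LFunctions.WeilBlockRows
import HarnessLib

/-!
# Moment-method certificates for TWISTED Weil weights: re-using kernel-checked `D C = I` rows across certificates

Cell `rh-explicit`, WEIL TRACK — GRH ARM (namespace `Summit.Ventures.WeilGRH`).  The twisted certificates `TwistCert`
(`TwistedMomentCert.lean`) re-use the Legendre change-of-basis blocks `C`, `D` of the tree's `ζ` certificate `weilCert3C`
(`N = 99`).  The row checks `D C = I` (`WeilCert.checkDCRow`, `WeilBlockRows.lean`) depend on a `WeilCert` record only
through `N` and the four block fields, so the fifty-plus-fifty kernel facts `checkDCRow{0,1}_{i}_weilCert3C` transfer to any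
record with the same blocks (`checkDCRow_congr`) at no kernel cost.  Pure proof file; nothing is asserted.
-/

noncomputable section

namespace Summit.Ventures.WeilGRH

open Literature.NumberTheory.LFunctions

/-- `checkDCRow` depends on the record only through `N`, `CE`, `CO`, `DE`, `DO`. [folklore] -/
theorem checkDCRow_congr {c c' : WeilCert} (hN : c.N = c'.N) (hCE : c.CE = c'.CE) (hCO : c.CO = c'.CO)
    (hDE : c.DE = c'.DE) (hDO : c.DO = c'.DO) {p i : ℕ} :
    c.checkDCRow p i = c'.checkDCRow p i := by
  unfold WeilCert.checkDCRow WeilCert.Cb WeilCert.Db WeilCert.nb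
  rw [hN, hCE, hCO, hDE, hDO]

end Summit.Ventures.WeilGRH

end
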